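import Summits.BirchSwinnertonDyer.Rank1Residual.P2.PrintCf2GenusPeriodMoverFourRank
import Literature.NumberTheory.QuadraticFields.RedeiReichardtConductorTwo
import HarnessLib

/-!
# Crux `PrintCf2.RamifiedOffTYZOfFacts` (item stmt-BirchSwinnertonDyer-20509; items 23431/23432 of route `PrintCf2` rev ≥ 33),
# line `offtyz-v7`: THE MOVER OF THE GENUS PERIOD `Z(d)` (`d ≡ 5 (mod 8)`) IS DECIDED BY THE RÉDEI MATRIX OF `−4d` —
# «some `g` trivial on `L_d(i)` moves `Z(d)`» ⟺ «`#{e ∈ 𝔽₂^t : RM(−4d)ᵀ e = 0, e₂ = 0} = 2`»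

Cell `bsd-print-cf2`, seat `bsd-print-cf2-ty2` (typer; the DISCHARGE INTERFACE), sequel of `PrintCf2GenusPeriodMoverFourRank.lean`
(`exists_mover_iff_fourTwoCard_eq_two`: mover ⟺ `fourTwoCard (Pic(𝒪₂)(K_d)) = 2`, i.e. `e₄(−16d) = 1`).  The Literature file
`Literature/NumberTheory/QuadraticFields/RedeiReichardtConductorTwo.lean` (this seat; Rédei–Reichardt run inside the order of conductor `2`,
Stevenhagen §2 + Cox Thm. 7.24 + Buell Prop. 4.17/Thm. 4.21) PROVES, for `K ∋ √−n`, `n ≡ 1 (mod 4)`, `n ≠ 1`, `p₁⋯p_t = 2n` the primes of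
`d_K = −4n`, `p_{i₂} = 2`, and a non-trivial square `κ` generating `ker(Pic(𝒪₂) → Cl(𝒪_K))`:
`fourTwoCard (Pic(𝒪₂)) = #{e ∈ 𝔽₂^t : RM(D)ᵀ e = 0 ∧ e_{i₂} = 0}` (`RM(D) = redeiMatrix n p`, Li–Ma Def. 0.2).  Hence, granted the
printed displays of a block `d ≡ 5 (mod 8)` (`CMBlockSpec`, `RingClassTwoBlockSpec`, which supply `κ = ρ_d(σ)`), the mover question —
the LEAD's `Cruxes/RamifiedOffTYZOfFacts/Lines/offtyz_v7_QForm.md` §2 (2a) «`c^Z_d ≠ 0 ⟺ e₄(−16d) = 1`», `offtyz_v7_TransferLayer.md` §4/§8 —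
is the FINITE LINEAR-ALGEBRA statement «the Rédei kernel of `−4d` has exactly two vectors vanishing at the prime `2`», `decide`-able per
family exactly like the tree's Rédei certificates (`RedeiMatrixFourRank.lean` §4–5); no datum of the display survives on the right-hand side.

* `fourTwoCard_ringClassGroup_two_genusField_eq_card` — `fourTwoCard (Pic(𝒪₂)(K_d)) = #{e : RM(−4d)ᵀ e = 0, e_{i₂} = 0}` for a displayed block;
* **`exists_mover_iff_card_redeiKernel_two_eq_two`** — mover ⟺ that count is `2`;
* `exists_galPt_Z_eq_add_tauOne_of_card_redeiKernel_two_eq_two` (count `= 2`: some `g` trivial on `L_d(i)` has `g·Z(d) = Z(d) + τ(1)`),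
  `galPt_Z_eq_of_card_redeiKernel_two_ne_two` (count `≠ 2`: every such `g` fixes `Z(d)`).

HONEST FRAMING: theorems only (no `def`, no named fact, no `sorry`); nothing here closes an item; the displays (`CMBlockSpec`,
`RingClassTwoBlockSpec`) remain hypotheses; BSD is not proved by any of this; no class is closed.  beyond-print theorem: NO (Rédei–Reichardt
for the order `𝒪₂` is classical — Rédei–Reichardt 1934 treat arbitrary quadratic discriminants; Buell 1989 Ch. 4, 9).

References: [cite: TianYuanZhang2017, Prop. 3.2 (1) (p0010 L108–L109), §3.1 (p0011 L1–L13), proof of Lemma 3.21 (p0020 L55–L62)];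
[cite: Stevenhagen1995RedeiMatrices, §2 Thm. 1]; [cite: LiMa2008, Def. 0.2, Thm. 0.4]; [cite: Cox2013, §7.D Thm. 7.24 and (7.25)–(7.27)];
[cite: Buell1989, Prop. 4.17, Thm. 4.21 (PDF pp. 37–40)].
-/

noncomputable section

open scoped Classical NumberField

open WeierstrassCurve WeierstrassCurve.Affine Literature.NumberTheory.EllipticCurves
  Literature.NumberTheory.EllipticCurves.TianYuanZhang2017
  Literature.NumberTheory.EllipticCurves.TianYuanZhang2017.W2
  Literature.NumberTheory.QuadraticFields.RingClass
  Literature.NumberTheory.QuadraticFields.Quadratic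
  Literature.NumberTheory.QuadraticFields
  Literature.NumberTheory.QuadraticFields.RedeiReichardt Matrix
open Literature.NumberTheory.EllipticCurves.Tian2014 (fourTwoCard)

set_option autoImplicit false

namespace Summit.BirchSwinnertonDyer.Rank1Residual.P2.GenusPeriodTransferLayer

variable {n : ℕ} (D : GenusPointData n)

/-- **`#(Pic(𝒪₂)² ∩ Pic(𝒪₂)[2])(K_d) = #{e : RM(−4d)ᵀ e = 0, e_{i₂} = 0}`** for a displayed block `d ≡ 5 (mod 8)` of a square-free `n`
(`p : Fin t → ℕ` the distinct primes of `2d`, `p_{i₂} = 2`): the Literature theorem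
`RedeiReichardt.fourTwoCard_ringClassGroup_two_eq_card_of_isQuadraticFieldOfSqrt` fed with `κ = ρ_d(σ)` (`≠ 1`, in `ker(→ Cl)`, a square since
`σ` is trivial on `L_d(i)` — all from the displays). [cite: Stevenhagen1995RedeiMatrices, §2 Thm. 1] [cite: Cox2013, §7.D Thm. 7.24]
[cite: TianYuanZhang2017, Prop. 3.2 (1) and proof of Lemma 3.21 (p0020 L55–L62)] -/
theorem fourTwoCard_ringClassGroup_two_genusField_eq_card {d : ℕ} (hd : d ∈ n.divisors) (hd8 : d % 8 = 5)
    {z : APoint D.H} {Φ : Finset (D.H ≃ₐ[ℚ] D.H)} {ΓH ΓH' : Subgroup (D.H ≃ₐ[ℚ] D.H)} {σ c : D.H ≃ₐ[ℚ] D.H}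
    (h : D.CMBlockSpec d z Φ ΓH ΓH' σ c) {ρ : D.galK d →* RingClassGroup (GenusField d) 2}
    (hρ : D.RingClassTwoBlockSpec d ΓH ΓH' ρ) {t : ℕ} {p : Fin t → ℕ} (hp : ∀ i, (p i).Prime)
    (hinj : Function.Injective p) (hprod : ∏ i, p i = 2 * d) {i₂ : Fin t} (hi₂ : p i₂ = 2) :
    fourTwoCard (RingClassGroup (GenusField d) 2) =
      Fintype.card {e : Fin t → ZMod 2 // (redeiMatrix d p)ᵀ *ᵥ e = 0 ∧ e i₂ = 0} := by
  have hd1 : 1 ≤ d := by omega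
  obtain ⟨hκ1, hκcl, -⟩ := kappa_spec_of_ringClass D hd hd8 h hρ
  have hκsq : IsSquare (ρ ⟨σ, D.sigma_mem_galK_of_cmBlockSpec h⟩) :=
    (hρ.2.2.2 _).mp (sigma_trivialOnL_and_not_mem_of_cmBlockSpec D hd hd8 h).1
  exact fourTwoCard_ringClassGroup_two_eq_card_of_isQuadraticFieldOfSqrt hp hinj (by rw [hprod, if_pos (by omega)])
    (by omega) (by omega) hi₂ (GenusField d) (isQuadraticFieldOfSqrt_genusField hd1) hκcl hκ1 hκsq

/-- **THE MOVER OF `Z(d)` IS DECIDED BY THE RÉDEI MATRIX OF `−4d`.**  For a displayed block `d ≡ 5 (mod 8)` of a square-free `n`, with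
`p : Fin t → ℕ` the distinct primes of `2d` and `p_{i₂} = 2`:
**`(∃ g trivial on L_d(i), g·Z(d) ≠ Z(d)) ⟺ #{e ∈ 𝔽₂^t : RM(−4d)ᵀ e = 0 ∧ e_{i₂} = 0} = 2`** — i.e. iff the `4`-rank of `C(−16d)` is
exactly one; the right-hand side is `decide`-able for every explicit family. [cite: Stevenhagen1995RedeiMatrices, §2 Thm. 1]
[cite: LiMa2008, Def. 0.2 and Thm. 0.4] [cite: TianYuanZhang2017, Prop. 3.2 (1), proof of Lemma 3.21 (p0020 L55–L62)] -/
theorem exists_mover_iff_card_redeiKernel_two_eq_two (hn : Squarefree n) {d : ℕ} (hd : d ∈ n.divisors) (hd8 : d % 8 = 5)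
    {z : APoint D.H} {Φ : Finset (D.H ≃ₐ[ℚ] D.H)} {ΓH ΓH' : Subgroup (D.H ≃ₐ[ℚ] D.H)} {σ c : D.H ≃ₐ[ℚ] D.H}
    (h : D.CMBlockSpec d z Φ ΓH ΓH' σ c) {ρ : D.galK d →* RingClassGroup (GenusField d) 2}
    (hρ : D.RingClassTwoBlockSpec d ΓH ΓH' ρ) {t : ℕ} {p : Fin t → ℕ} (hp : ∀ i, (p i).Prime)
    (hinj : Function.Injective p) (hprod : ∏ i, p i = 2 * d) {i₂ : Fin t} (hi₂ : p i₂ = 2) :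
    (∃ g : D.H ≃ₐ[ℚ] D.H, D.TrivialOnL d g ∧ D.galPt g (D.Z d) ≠ D.Z d) ↔
      Fintype.card {e : Fin t → ZMod 2 // (redeiMatrix d p)ᵀ *ᵥ e = 0 ∧ e i₂ = 0} = 2 := by
  rw [exists_mover_iff_fourTwoCard_eq_two D hn hd hd8 h hρ,
    fourTwoCard_ringClassGroup_two_genusField_eq_card D hd hd8 h hρ hp hinj hprod hi₂]

/-- Count `= 2`: some automorphism trivial on `L_d(i)` moves `Z(d)`, by exactly `τ(1)`.
[cite: TianYuanZhang2017, Prop. 3.2 (1), Thm. 3.6 (1), proof of Lemma 3.21 (p0020 L55–L62)] [cite: Stevenhagen1995RedeiMatrices, §2 Thm. 1] -/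
theorem exists_galPt_Z_eq_add_tauOne_of_card_redeiKernel_two_eq_two (hn : Squarefree n) {d : ℕ} (hd : d ∈ n.divisors)
    (hd8 : d % 8 = 5) {z : APoint D.H} {Φ : Finset (D.H ≃ₐ[ℚ] D.H)} {ΓH ΓH' : Subgroup (D.H ≃ₐ[ℚ] D.H)}
    {σ c : D.H ≃ₐ[ℚ] D.H} (h : D.CMBlockSpec d z Φ ΓH ΓH' σ c) {ρ : D.galK d →* RingClassGroup (GenusField d) 2}
    (hρ : D.RingClassTwoBlockSpec d ΓH ΓH' ρ) {t : ℕ} {p : Fin t → ℕ} (hp : ∀ i, (p i).Prime)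
    (hinj : Function.Injective p) (hprod : ∏ i, p i = 2 * d) {i₂ : Fin t} (hi₂ : p i₂ = 2)
    (hcount : Fintype.card {e : Fin t → ZMod 2 // (redeiMatrix d p)ᵀ *ᵥ e = 0 ∧ e i₂ = 0} = 2) :
    ∃ g : D.H ≃ₐ[ℚ] D.H, D.TrivialOnL d g ∧ D.galPt g (D.Z d) = D.Z d + tauOne ∧ D.galPt g (D.Z d) ≠ D.Z d := by
  obtain ⟨g, hg, hne⟩ := (exists_mover_iff_card_redeiKernel_two_eq_two D hn hd hd8 h hρ hp hinj hprod hi₂).mpr hcount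
  exact ⟨g, hg, (galPt_genusPeriod_ne_iff_of_cmBlockSpec D hd hd8 h hg).2
    ((galPt_genusPeriod_ne_iff_of_cmBlockSpec D hd hd8 h hg).1.mp hne), hne⟩

/-- Count `≠ 2` (the `4`-rank of `C(−16d)` is `0` or `≥ 2`): every automorphism trivial on `L_d(i)` FIXES `Z(d)`.
[cite: TianYuanZhang2017, proof of Lemma 3.21 (p0020 L55–L62)] [cite: Stevenhagen1995RedeiMatrices, §2 Thm. 1] -/
theorem galPt_Z_eq_of_card_redeiKernel_two_ne_two (hn : Squarefree n) {d : ℕ} (hd : d ∈ n.divisors) (hd8 : d % 8 = 5)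
    {z : APoint D.H} {Φ : Finset (D.H ≃ₐ[ℚ] D.H)} {ΓH ΓH' : Subgroup (D.H ≃ₐ[ℚ] D.H)} {σ c : D.H ≃ₐ[ℚ] D.H}
    (h : D.CMBlockSpec d z Φ ΓH ΓH' σ c) {ρ : D.galK d →* RingClassGroup (GenusField d) 2}
    (hρ : D.RingClassTwoBlockSpec d ΓH ΓH' ρ) {t : ℕ} {p : Fin t → ℕ} (hp : ∀ i, (p i).Prime)
    (hinj : Function.Injective p) (hprod : ∏ i, p i = 2 * d) {i₂ : Fin t} (hi₂ : p i₂ = 2)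
    (hcount : Fintype.card {e : Fin t → ZMod 2 // (redeiMatrix d p)ᵀ *ᵥ e = 0 ∧ e i₂ = 0} ≠ 2)
    {g : D.H ≃ₐ[ℚ] D.H} (hg : D.TrivialOnL d g) : D.galPt g (D.Z d) = D.Z d := by
  by_contra hne
  exact hcount ((exists_mover_iff_card_redeiKernel_two_eq_two D hn hd hd8 h hρ hp hinj hprod hi₂).mp ⟨g, hg, hne⟩)

end Summit.BirchSwinnertonDyer.Rank1Residual.P2.GenusPeriodTransferLayer

end
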